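import Mathlib
import HarnessLib.Audit
import Summits.PneNP.PneNP.Theorems.PstarGapTwoTerminal
import Summits.PneNP.PneNP.Theorems.PstarGSystemGraphGap
import Summits.PneNP.PneNP.Theorems.PstarChordEndgameTools

/-!
# Two constraints: empty core or a chordal core (ROUND-24, GAPTWO-PLAN S1 + S3-base assembled)

FRONTIER range-avoidance ladder, rung F-N3, ROUND 24 (cell `pnp-ideate`; restricted-model proof complexity — nothing here bears
on `P` versus `NP`).

Assembly of the landed pieces around `PstarGapTwo.GapTwo` (T24.18 at `h = 2`): for a minimal infeasible `(J, W)` with `|W| ≤ 2` on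
an expanding typed pure instance with simple overlaps and maximum degree `Δ`, take the terminal normal form
(`PstarGapTwoTerminal.terminal_form`).  If its core is EMPTY, every output was folded and the G-system is an unsat edge-minimal
graph-quadratic system, so `|J| ≤ 8Δ²` (`PstarGSystemGraphGap.card_le_of_core_empty`, T24.11c underneath).  Otherwise the core `J₀`
is non-empty, has no private XOR slot, and — by boundary expansion, `PstarChordEndgameTools.three_card_le` — contains a CHORD
(an output with both AND slots `J₀`-private); this is the configuration the open item S4 of `GAPTWO-PLAN.md` must bound
(`small_or_chordal_core`).
-/

set_option linter.dupNamespace false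

open Finset Literature.Computability.Complexity
open Summit.PneNP.PneNP.Theorems.PstarTyped (Typed)
open Summit.PneNP.PneNP.Theorems.PstarSALevel (varSet bdry BoundaryExpanding SimpleOverlap)
open Summit.PneNP.PneNP.Theorems.PstarGapLemma (MinInfeasible MaxDegree)
open Summit.PneNP.PneNP.Theorems.PstarGapOneAll (gval)
open Summit.PneNP.PneNP.Theorems.PstarChordRepair (IsChord)
open Summit.PneNP.PneNP.Theorems.PstarChordEndgameTools (privAnd three_card_le card_privAnd_le_one)
open Summit.PneNP.PneNP.Theorems.PstarGapTwoTerminal (terminal_form)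
open Summit.PneNP.PneNP.Theorems.PstarGSystemGraphGap (card_le_of_core_empty)

namespace Summit.PneNP.PneNP.Theorems.PstarGapTwoDichotomy

variable {n m : ℕ}

/-- **A core without private XOR slots is empty or has a chord** (boundary expansion). -/
theorem exists_chord_of_no_private_xor (I : LocalMap 4 n m) {r : ℕ} (hB : BoundaryExpanding r I) {J₀ : Finset (Fin m)}
    (hJr : J₀.card ≤ r) (hT1 : ∀ f ∈ J₀, ∀ s : Fin 4, s.val < 2 → I.vars f s ∉ bdry I J₀) (hne : J₀.Nonempty) :
    ∃ g ∈ J₀, IsChord I J₀ g := by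
  classical
  by_contra hno
  push Not at hno
  have h3 := three_card_le I J₀ hB hJr hT1
  have hle : ∑ f ∈ J₀, (privAnd I J₀ f).card ≤ J₀.card := by
    calc ∑ f ∈ J₀, (privAnd I J₀ f).card ≤ ∑ _f ∈ J₀, 1 := sum_le_sum fun f hf => card_privAnd_le_one I J₀ (hno f hf)
      _ = J₀.card := by rw [sum_const, smul_eq_mul, mul_one]
  have hpos := hne.card_pos
  omega

/-- **Small, or a chordal core.**  For a minimal infeasible `(J, W)` with `|W| ≤ 2`: either `|J| ≤ 8Δ²`, or the terminal normal
form has a NON-EMPTY core `J₀` (no `J₀`-private XOR slot, constraint variables read, unsat with (M0) and the flip property (M′),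
monomials = `J ∖ J₀`) containing a chord. -/
theorem small_or_chordal_core {Δ r : ℕ} (I : LocalMap 4 n m) (hI : I.IsPure xorAndPred) (hT : Typed I) (hS : SimpleOverlap I)
    (hB : BoundaryExpanding r I) (hD : MaxDegree Δ I) (y : Fin m → Bool) (W : Finset (Finset (Fin n) × Bool)) (J : Finset (Fin m))
    (hW : W.card ≤ 2) (hJr : J.card ≤ r) (hmin : MinInfeasible I y W J) :
    J.card ≤ 8 * Δ ^ 2 ∨
    ∃ (J₀ : Finset (Fin m)) (𝒲 : Finset (Finset (Fin n) × Finset (Fin m) × Bool)),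
      J₀ ⊆ J ∧ J₀.Nonempty ∧ (∃ g ∈ J₀, IsChord I J₀ g) ∧ 𝒲.card ≤ W.card ∧ (∀ w ∈ 𝒲, w.2.1 ⊆ J \ J₀) ∧
      (∀ g ∈ J \ J₀, ∃ w ∈ 𝒲, g ∈ w.2.1) ∧
      (∀ f ∈ J₀, ∀ s : Fin 4, s.val < 2 → I.vars f s ∉ bdry I J₀) ∧
      (∀ w ∈ 𝒲, ∀ v ∈ w.1, (∃ f ∈ J₀, v ∈ varSet I f) ∨ ∃ w' ∈ 𝒲, ∃ g ∈ w'.2.1, I.vars g 2 = v ∨ I.vars g 3 = v) ∧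
      (¬ ∃ z : Fin n → Bool, (∀ j ∈ J₀, I.eval z j = y j) ∧ ∀ w ∈ 𝒲, gval I w.1 w.2.1 z = w.2.2) ∧
      (∀ f ∈ J₀, ∃ z : Fin n → Bool, (∀ j ∈ J₀.erase f, I.eval z j = y j) ∧ ∀ w ∈ 𝒲, gval I w.1 w.2.1 z = w.2.2) ∧
      (∀ g ∈ J \ J₀, ∃ z : Fin n → Bool, (∀ j ∈ J₀, I.eval z j = y j) ∧
        ∀ w ∈ 𝒲, (gval I w.1 w.2.1 z = w.2.2 ↔ g ∉ w.2.1)) := by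
  classical
  obtain ⟨J₀, 𝒲, hsub, hcard, hmono, hcov, hT1, hT2, hU, hM0, hflip⟩ := terminal_form I hI hT y W J hmin
  rcases J₀.eq_empty_or_nonempty with hJ₀ | hne
  · left
    subst hJ₀
    refine card_le_of_core_empty I hI hS hD J 𝒲 (hcard.trans hW) (fun w hw => (hmono w hw).trans sdiff_subset)
      (fun g hg => hcov g (by simpa using hg)) (fun ⟨z, hz⟩ => hU ⟨z, by simp, hz⟩) fun g hg => ?_
    obtain ⟨z, -, hz⟩ := hflip g (by simpa using hg)
    exact ⟨z, hz⟩
  · right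
    exact ⟨J₀, 𝒲, hsub, hne, exists_chord_of_no_private_xor I hB ((card_le_card hsub).trans hJr) hT1 hne, hcard, hmono, hcov, hT1,
      hT2, hU, hM0, hflip⟩

end Summit.PneNP.PneNP.Theorems.PstarGapTwoDichotomy
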